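import Summits.CriticalPhenomena.PercolationContinuityZ3.Theorems.PercNearOneGluingNoHeavyLowerTailNineTypeLabelCert

/-!
# Label atlas: new all-`n` antipodal packings certified by the nine-type tables

Support file for crux `stmt-CriticalPhenomena-4575` (master-family programme, four-point quadratic rows), seat `prim-bnk-1`
gen 20; memo `run/shared/lean/prim/prim-l12/FROM-prim-bnk-1-gen20-LABEL-ATLAS.md`.

Each entry is a label certificate `(P, lab)` in the sense of `…NineTypeLabelCert`: `tableOK P lab` is checked by `decide`, and
`TwoCopyMono.pack_of_tableOK` turns it into the packing inequality
`Σ_{(h,l) ∈ P} cell h · cell l ≤ (cell(ab|cy) + cell(abcy)) · cell(a|b|c|y)` for EVERY finite weighted graph and all marked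
points (Bernoulli bond percolation `P_w` on `Fin n`, all `n`; cells indexed as in `FourPointAtoms.pat4`).
The complete atlas (all maximal certificates: 966 type sets, 135 classes under the stabiliser of `ab|cy`, sizes 5–10; `Q44b`'s
nine types are one of them) is tabulated in the memo; landed here: the weight-two part of the row `Q44` and its two
partner-dart extensions, two dart triples, and one representative of each of the four classes of ten-product certificates
(the largest ones; none is a sub-packing of `Q44b` or of its mirror images).
Pure table checks + `linarith`; no named facts, no sorries, standard axioms.
-/

namespace Summit.CriticalPhenomena.PercolationContinuityZ3.Theorems

namespace TwoCopyMono

open Finset FourPointAtoms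

variable {n : ℕ}

/-- Table check for the weight-two part `B1` of the row `Q44` (its five ±2 products): (heavy, light, label) = (ab|cy, ac|by, 5), (ab|cy, ay|bc, 5), (ab|c|y, ay|bc, 5), (a|b|cy, ab|c|y, 8), (a|b|cy, ay|bc, 6). [this work] -/
theorem tableOK_q44WeightTwo :
    tableOK ({(11, 9), (11, 8), (6, 8), (1, 6), (1, 8)} : Finset (Fin 15 × Fin 15))
      (fun p => if p = (11, 9) then 5 else if p = (11, 8) then 5 else if p = (6, 8) then 5 else if p = (1, 6) then 8 else 6) := by
  decide +kernel

/-- **Packing, all `n`** (the weight-two part `B1` of the row `Q44` (its five ±2 products)):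
`P(ab|cy)·P(ac|by) + P(ab|cy)·P(ay|bc) + P(ab|c|y)·P(ay|bc) + P(a|b|cy)·P(ab|c|y) + P(a|b|cy)·P(ay|bc) ≤ [P(ab|cy)+P(abcy)]·P(a|b|c|y)` on every finite weighted graph. [this work] -/
theorem pack_q44WeightTwo (w : Sym2 (Fin n) → unitInterval) (a b c y : Fin n) :
    cell w a b c y 11 * cell w a b c y 9 +
      cell w a b c y 11 * cell w a b c y 8 +
      cell w a b c y 6 * cell w a b c y 8 +
      cell w a b c y 1 * cell w a b c y 6 +
      cell w a b c y 1 * cell w a b c y 8 ≤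
      (cell w a b c y 11 + cell w a b c y 14) * cell w a b c y 0 := by
  have h := pack_of_tableOK _ _ tableOK_q44WeightTwo w a b c y
  rw [Finset.sum_insert (by decide), Finset.sum_insert (by decide), Finset.sum_insert (by decide), Finset.sum_insert (by decide), Finset.sum_singleton] at h
  dsimp only at h
  linarith

/-- Table check for `B1` together with the two partner darts at the pair `{c,y}`: (heavy, light, label) = (ab|cy, ac|by, 5), (ab|cy, ay|bc, 5), (ab|c|y, ay|bc, 6), (ab|c|y, a|b|cy, 8), (a|b|cy, ay|bc, 5), (abc|y, a|b|cy, 8), (aby|c, a|b|cy, 8). [this work] -/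
theorem tableOK_q44WeightTwo_cyDarts :
    tableOK ({(11, 9), (11, 8), (6, 8), (6, 1), (1, 8), (13, 1), (12, 1)} : Finset (Fin 15 × Fin 15))
      (fun p => if p = (11, 9) then 5 else if p = (11, 8) then 5 else if p = (6, 8) then 6 else if p = (6, 1) then 8 else if p = (1, 8) then 5 else if p = (13, 1) then 8 else 8) := by
  decide +kernel

/-- **Packing, all `n`** (`B1` together with the two partner darts at the pair `{c,y}`):
`P(ab|cy)·P(ac|by) + P(ab|cy)·P(ay|bc) + P(ab|c|y)·P(ay|bc) + P(ab|c|y)·P(a|b|cy) + P(a|b|cy)·P(ay|bc) + P(abc|y)·P(a|b|cy) + P(aby|c)·P(a|b|cy) ≤ [P(ab|cy)+P(abcy)]·P(a|b|c|y)` on every finite weighted graph. [this work] -/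
theorem pack_q44WeightTwo_cyDarts (w : Sym2 (Fin n) → unitInterval) (a b c y : Fin n) :
    cell w a b c y 11 * cell w a b c y 9 +
      cell w a b c y 11 * cell w a b c y 8 +
      cell w a b c y 6 * cell w a b c y 8 +
      cell w a b c y 6 * cell w a b c y 1 +
      cell w a b c y 1 * cell w a b c y 8 +
      cell w a b c y 13 * cell w a b c y 1 +
      cell w a b c y 12 * cell w a b c y 1 ≤
      (cell w a b c y 11 + cell w a b c y 14) * cell w a b c y 0 := by
  have h := pack_of_tableOK _ _ tableOK_q44WeightTwo_cyDarts w a b c y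
  rw [Finset.sum_insert (by decide), Finset.sum_insert (by decide), Finset.sum_insert (by decide), Finset.sum_insert (by decide), Finset.sum_insert (by decide), Finset.sum_insert (by decide), Finset.sum_singleton] at h
  dsimp only at h
  linarith

/-- Table check for `B1` together with the two partner darts at the pair `{a,b}`: (heavy, light, label) = (ab|cy, ac|by, 5), (ab|cy, ay|bc, 5), (ab|c|y, ay|bc, 5), (a|b|cy, ab|c|y, 8), (a|b|cy, ay|bc, 6), (acy|b, ab|c|y, 8), (a|bcy, ab|c|y, 8). [this work] -/
theorem tableOK_q44WeightTwo_abDarts :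
    tableOK ({(11, 9), (11, 8), (6, 8), (1, 6), (1, 8), (10, 6), (7, 6)} : Finset (Fin 15 × Fin 15))
      (fun p => if p = (11, 9) then 5 else if p = (11, 8) then 5 else if p = (6, 8) then 5 else if p = (1, 6) then 8 else if p = (1, 8) then 6 else if p = (10, 6) then 8 else 8) := by
  decide +kernel

/-- **Packing, all `n`** (`B1` together with the two partner darts at the pair `{a,b}`):
`P(ab|cy)·P(ac|by) + P(ab|cy)·P(ay|bc) + P(ab|c|y)·P(ay|bc) + P(a|b|cy)·P(ab|c|y) + P(a|b|cy)·P(ay|bc) + P(acy|b)·P(ab|c|y) + P(a|bcy)·P(ab|c|y) ≤ [P(ab|cy)+P(abcy)]·P(a|b|c|y)` on every finite weighted graph. [this work] -/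
theorem pack_q44WeightTwo_abDarts (w : Sym2 (Fin n) → unitInterval) (a b c y : Fin n) :
    cell w a b c y 11 * cell w a b c y 9 +
      cell w a b c y 11 * cell w a b c y 8 +
      cell w a b c y 6 * cell w a b c y 8 +
      cell w a b c y 1 * cell w a b c y 6 +
      cell w a b c y 1 * cell w a b c y 8 +
      cell w a b c y 10 * cell w a b c y 6 +
      cell w a b c y 7 * cell w a b c y 6 ≤
      (cell w a b c y 11 + cell w a b c y 14) * cell w a b c y 0 := by
  have h := pack_of_tableOK _ _ tableOK_q44WeightTwo_abDarts w a b c y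
  rw [Finset.sum_insert (by decide), Finset.sum_insert (by decide), Finset.sum_insert (by decide), Finset.sum_insert (by decide), Finset.sum_insert (by decide), Finset.sum_insert (by decide), Finset.sum_singleton] at h
  dsimp only at h
  linarith

/-- Table check for the dart triple at `y` (both darts at `y` and the dart `c → y`): (heavy, light, label) = (abc|y, a|by|c, 1), (abc|y, a|b|cy, 8), (a|b|cy, aby|c, 7). [this work] -/
theorem tableOK_dartTriple_y :
    tableOK ({(13, 2), (13, 1), (1, 12)} : Finset (Fin 15 × Fin 15))
      (fun p => if p = (13, 2) then 1 else if p = (13, 1) then 8 else 7) := by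
  decide +kernel

/-- **Packing, all `n`** (the dart triple at `y` (both darts at `y` and the dart `c → y`)):
`P(abc|y)·P(a|by|c) + P(abc|y)·P(a|b|cy) + P(a|b|cy)·P(aby|c) ≤ [P(ab|cy)+P(abcy)]·P(a|b|c|y)` on every finite weighted graph. [this work] -/
theorem pack_dartTriple_y (w : Sym2 (Fin n) → unitInterval) (a b c y : Fin n) :
    cell w a b c y 13 * cell w a b c y 2 +
      cell w a b c y 13 * cell w a b c y 1 +
      cell w a b c y 1 * cell w a b c y 12 ≤
      (cell w a b c y 11 + cell w a b c y 14) * cell w a b c y 0 := by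
  have h := pack_of_tableOK _ _ tableOK_dartTriple_y w a b c y
  rw [Finset.sum_insert (by decide), Finset.sum_insert (by decide), Finset.sum_singleton] at h
  dsimp only at h
  linarith

/-- Table check for the dart triple at `a` (both darts at `a` and the dart `b → a`): (heavy, light, label) = (ab|c|y, a|bcy, 5), (ac|b|y, a|bcy, 3), (acy|b, ab|c|y, 8). [this work] -/
theorem tableOK_dartTriple_a :
    tableOK ({(6, 7), (5, 7), (10, 6)} : Finset (Fin 15 × Fin 15))
      (fun p => if p = (6, 7) then 5 else if p = (5, 7) then 3 else 8) := by
  decide +kernel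

/-- **Packing, all `n`** (the dart triple at `a` (both darts at `a` and the dart `b → a`)):
`P(ab|c|y)·P(a|bcy) + P(ac|b|y)·P(a|bcy) + P(acy|b)·P(ab|c|y) ≤ [P(ab|cy)+P(abcy)]·P(a|b|c|y)` on every finite weighted graph. [this work] -/
theorem pack_dartTriple_a (w : Sym2 (Fin n) → unitInterval) (a b c y : Fin n) :
    cell w a b c y 6 * cell w a b c y 7 +
      cell w a b c y 5 * cell w a b c y 7 +
      cell w a b c y 10 * cell w a b c y 6 ≤
      (cell w a b c y 11 + cell w a b c y 14) * cell w a b c y 0 := by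
  have h := pack_of_tableOK _ _ tableOK_dartTriple_a w a b c y
  rw [Finset.sum_insert (by decide), Finset.sum_insert (by decide), Finset.sum_singleton] at h
  dsimp only at h
  linarith

/-- Table check for a maximal certificate with ten products (class 1 of 4 under the stabiliser of `ab|cy`; 4 members): (heavy, light, label) = (abc|y, ay|b|c, 8), (ab|cy, ac|by, 1), (ay|bc, ab|cy, 5), (ay|b|c, ab|cy, 7), (a|bc|y, ab|cy, 6), (ay|bc, ac|by, 7), (ab|c|y, ac|by, 1), (ay|b|c, ac|by, 7), (a|b|cy, ac|by, 1), (a|bcy, ay|b|c, 8). [this work] -/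
theorem tableOK_ten01 :
    tableOK ({(13, 4), (11, 9), (8, 11), (4, 11), (3, 11), (8, 9), (6, 9), (4, 9), (1, 9), (7, 4)} : Finset (Fin 15 × Fin 15))
      (fun p => if p = (13, 4) then 8 else if p = (11, 9) then 1 else if p = (8, 11) then 5 else if p = (4, 11) then 7 else if p = (3, 11) then 6 else if p = (8, 9) then 7 else if p = (6, 9) then 1 else if p = (4, 9) then 7 else if p = (1, 9) then 1 else 8) := by
  decide +kernel

/-- **Packing, all `n`** (a maximal certificate with ten products (class 1 of 4 under the stabiliser of `ab|cy`; 4 members)):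
`P(abc|y)·P(ay|b|c) + P(ab|cy)·P(ac|by) + P(ay|bc)·P(ab|cy) + P(ay|b|c)·P(ab|cy) + P(a|bc|y)·P(ab|cy) + P(ay|bc)·P(ac|by) + P(ab|c|y)·P(ac|by) + P(ay|b|c)·P(ac|by) + P(a|b|cy)·P(ac|by) + P(a|bcy)·P(ay|b|c) ≤ [P(ab|cy)+P(abcy)]·P(a|b|c|y)` on every finite weighted graph. [this work] -/
theorem pack_ten01 (w : Sym2 (Fin n) → unitInterval) (a b c y : Fin n) :
    cell w a b c y 13 * cell w a b c y 4 +
      cell w a b c y 11 * cell w a b c y 9 +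
      cell w a b c y 8 * cell w a b c y 11 +
      cell w a b c y 4 * cell w a b c y 11 +
      cell w a b c y 3 * cell w a b c y 11 +
      cell w a b c y 8 * cell w a b c y 9 +
      cell w a b c y 6 * cell w a b c y 9 +
      cell w a b c y 4 * cell w a b c y 9 +
      cell w a b c y 1 * cell w a b c y 9 +
      cell w a b c y 7 * cell w a b c y 4 ≤
      (cell w a b c y 11 + cell w a b c y 14) * cell w a b c y 0 := by
  have h := pack_of_tableOK _ _ tableOK_ten01 w a b c y
  rw [Finset.sum_insert (by decide), Finset.sum_insert (by decide), Finset.sum_insert (by decide), Finset.sum_insert (by decide), Finset.sum_insert (by decide), Finset.sum_insert (by decide), Finset.sum_insert (by decide), Finset.sum_insert (by decide), Finset.sum_insert (by decide), Finset.sum_singleton] at h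
  dsimp only at h
  linarith

/-- Table check for a maximal certificate with ten products (class 2 of 4 under the stabiliser of `ab|cy`; 4 members): (heavy, light, label) = (aby|c, ac|b|y, 8), (ac|by, ab|cy, 5), (ab|cy, ay|bc, 1), (ac|b|y, ab|cy, 7), (a|by|c, ab|cy, 6), (ab|c|y, ay|bc, 1), (ac|b|y, ay|bc, 7), (a|by|c, ay|bc, 3), (a|b|cy, ay|bc, 1), (a|bcy, ac|b|y, 8). [this work] -/
theorem tableOK_ten02 :
    tableOK ({(12, 5), (9, 11), (11, 8), (5, 11), (2, 11), (6, 8), (5, 8), (2, 8), (1, 8), (7, 5)} : Finset (Fin 15 × Fin 15))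
      (fun p => if p = (12, 5) then 8 else if p = (9, 11) then 5 else if p = (11, 8) then 1 else if p = (5, 11) then 7 else if p = (2, 11) then 6 else if p = (6, 8) then 1 else if p = (5, 8) then 7 else if p = (2, 8) then 3 else if p = (1, 8) then 1 else 8) := by
  decide +kernel

/-- **Packing, all `n`** (a maximal certificate with ten products (class 2 of 4 under the stabiliser of `ab|cy`; 4 members)):
`P(aby|c)·P(ac|b|y) + P(ac|by)·P(ab|cy) + P(ab|cy)·P(ay|bc) + P(ac|b|y)·P(ab|cy) + P(a|by|c)·P(ab|cy) + P(ab|c|y)·P(ay|bc) + P(ac|b|y)·P(ay|bc) + P(a|by|c)·P(ay|bc) + P(a|b|cy)·P(ay|bc) + P(a|bcy)·P(ac|b|y) ≤ [P(ab|cy)+P(abcy)]·P(a|b|c|y)` on every finite weighted graph. [this work] -/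
theorem pack_ten02 (w : Sym2 (Fin n) → unitInterval) (a b c y : Fin n) :
    cell w a b c y 12 * cell w a b c y 5 +
      cell w a b c y 9 * cell w a b c y 11 +
      cell w a b c y 11 * cell w a b c y 8 +
      cell w a b c y 5 * cell w a b c y 11 +
      cell w a b c y 2 * cell w a b c y 11 +
      cell w a b c y 6 * cell w a b c y 8 +
      cell w a b c y 5 * cell w a b c y 8 +
      cell w a b c y 2 * cell w a b c y 8 +
      cell w a b c y 1 * cell w a b c y 8 +
      cell w a b c y 7 * cell w a b c y 5 ≤
      (cell w a b c y 11 + cell w a b c y 14) * cell w a b c y 0 := by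
  have h := pack_of_tableOK _ _ tableOK_ten02 w a b c y
  rw [Finset.sum_insert (by decide), Finset.sum_insert (by decide), Finset.sum_insert (by decide), Finset.sum_insert (by decide), Finset.sum_insert (by decide), Finset.sum_insert (by decide), Finset.sum_insert (by decide), Finset.sum_insert (by decide), Finset.sum_insert (by decide), Finset.sum_singleton] at h
  dsimp only at h
  linarith

/-- Table check for a maximal certificate with ten products (class 3 of 4 under the stabiliser of `ab|cy`; 2 members): (heavy, light, label) = (ab|cy, ac|by, 8), (ay|bc, ab|cy, 6), (ab|cy, ac|b|y, 8), (ay|b|c, ab|cy, 6), (a|bc|y, ab|cy, 6), (ab|cy, a|by|c, 8), (ay|bc, ac|by, 6), (ay|b|c, ac|by, 6), (a|bc|y, ac|by, 6), (ab|c|y, a|b|cy, 1). [this work] -/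
theorem tableOK_ten03 :
    tableOK ({(11, 9), (8, 11), (11, 5), (4, 11), (3, 11), (11, 2), (8, 9), (4, 9), (3, 9), (6, 1)} : Finset (Fin 15 × Fin 15))
      (fun p => if p = (11, 9) then 8 else if p = (8, 11) then 6 else if p = (11, 5) then 8 else if p = (4, 11) then 6 else if p = (3, 11) then 6 else if p = (11, 2) then 8 else if p = (8, 9) then 6 else if p = (4, 9) then 6 else if p = (3, 9) then 6 else 1) := by
  decide +kernel

/-- **Packing, all `n`** (a maximal certificate with ten products (class 3 of 4 under the stabiliser of `ab|cy`; 2 members)):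
`P(ab|cy)·P(ac|by) + P(ay|bc)·P(ab|cy) + P(ab|cy)·P(ac|b|y) + P(ay|b|c)·P(ab|cy) + P(a|bc|y)·P(ab|cy) + P(ab|cy)·P(a|by|c) + P(ay|bc)·P(ac|by) + P(ay|b|c)·P(ac|by) + P(a|bc|y)·P(ac|by) + P(ab|c|y)·P(a|b|cy) ≤ [P(ab|cy)+P(abcy)]·P(a|b|c|y)` on every finite weighted graph. [this work] -/
theorem pack_ten03 (w : Sym2 (Fin n) → unitInterval) (a b c y : Fin n) :
    cell w a b c y 11 * cell w a b c y 9 +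
      cell w a b c y 8 * cell w a b c y 11 +
      cell w a b c y 11 * cell w a b c y 5 +
      cell w a b c y 4 * cell w a b c y 11 +
      cell w a b c y 3 * cell w a b c y 11 +
      cell w a b c y 11 * cell w a b c y 2 +
      cell w a b c y 8 * cell w a b c y 9 +
      cell w a b c y 4 * cell w a b c y 9 +
      cell w a b c y 3 * cell w a b c y 9 +
      cell w a b c y 6 * cell w a b c y 1 ≤
      (cell w a b c y 11 + cell w a b c y 14) * cell w a b c y 0 := by
  have h := pack_of_tableOK _ _ tableOK_ten03 w a b c y
  rw [Finset.sum_insert (by decide), Finset.sum_insert (by decide), Finset.sum_insert (by decide), Finset.sum_insert (by decide), Finset.sum_insert (by decide), Finset.sum_insert (by decide), Finset.sum_insert (by decide), Finset.sum_insert (by decide), Finset.sum_insert (by decide), Finset.sum_singleton] at h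
  dsimp only at h
  linarith

/-- Table check for a maximal certificate with ten products (class 4 of 4 under the stabiliser of `ab|cy`; 4 members): (heavy, light, label) = (abc|y, a|b|cy, 8), (aby|c, a|b|cy, 8), (ab|cy, ac|by, 5), (ay|bc, ac|by, 3), (ab|c|y, ac|by, 6), (ay|b|c, ac|by, 3), (a|bc|y, ac|by, 3), (a|b|cy, ac|by, 5), (ay|bc, a|b|cy, 8), (ab|c|y, a|b|cy, 8). [this work] -/
theorem tableOK_ten04 :
    tableOK ({(13, 1), (12, 1), (11, 9), (8, 9), (6, 9), (4, 9), (3, 9), (1, 9), (8, 1), (6, 1)} : Finset (Fin 15 × Fin 15))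
      (fun p => if p = (13, 1) then 8 else if p = (12, 1) then 8 else if p = (11, 9) then 5 else if p = (8, 9) then 3 else if p = (6, 9) then 6 else if p = (4, 9) then 3 else if p = (3, 9) then 3 else if p = (1, 9) then 5 else if p = (8, 1) then 8 else 8) := by
  decide +kernel

/-- **Packing, all `n`** (a maximal certificate with ten products (class 4 of 4 under the stabiliser of `ab|cy`; 4 members)):
`P(abc|y)·P(a|b|cy) + P(aby|c)·P(a|b|cy) + P(ab|cy)·P(ac|by) + P(ay|bc)·P(ac|by) + P(ab|c|y)·P(ac|by) + P(ay|b|c)·P(ac|by) + P(a|bc|y)·P(ac|by) + P(a|b|cy)·P(ac|by) + P(ay|bc)·P(a|b|cy) + P(ab|c|y)·P(a|b|cy) ≤ [P(ab|cy)+P(abcy)]·P(a|b|c|y)` on every finite weighted graph. [this work] -/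
theorem pack_ten04 (w : Sym2 (Fin n) → unitInterval) (a b c y : Fin n) :
    cell w a b c y 13 * cell w a b c y 1 +
      cell w a b c y 12 * cell w a b c y 1 +
      cell w a b c y 11 * cell w a b c y 9 +
      cell w a b c y 8 * cell w a b c y 9 +
      cell w a b c y 6 * cell w a b c y 9 +
      cell w a b c y 4 * cell w a b c y 9 +
      cell w a b c y 3 * cell w a b c y 9 +
      cell w a b c y 1 * cell w a b c y 9 +
      cell w a b c y 8 * cell w a b c y 1 +
      cell w a b c y 6 * cell w a b c y 1 ≤
      (cell w a b c y 11 + cell w a b c y 14) * cell w a b c y 0 := by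
  have h := pack_of_tableOK _ _ tableOK_ten04 w a b c y
  rw [Finset.sum_insert (by decide), Finset.sum_insert (by decide), Finset.sum_insert (by decide), Finset.sum_insert (by decide), Finset.sum_insert (by decide), Finset.sum_insert (by decide), Finset.sum_insert (by decide), Finset.sum_insert (by decide), Finset.sum_insert (by decide), Finset.sum_singleton] at h
  dsimp only at h
  linarith

end TwoCopyMono

end Summit.CriticalPhenomena.PercolationContinuityZ3.Theorems
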